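/-
Copyright (c) 2026 the pub-hodgecm-mathlib formalisation cell (harness21).  Prover seat hodgecm-mathlib-F0P2-p07 (g2): Track B «K2-LIT»,
hLiu418 = stmt-HodgeConjecture-24832; (σ-A) road desk K2Liu-p25 (g3∕g4) WORD #51 (C) ∕ WORD (g4) #2 (4) «(C) §3»; consumer K2Liu-p08 (g6) (an-3c)
(cut 03:05:41Z: «(C) INNER = (W-w₂)@point §3 + ★ p864180»).
-/
import Summits.HodgeConjecture.HodgeConjecture.Theorems.K2LiuLocalSWCornerVectorAtPoint          -- ★ p864761∕p865053 (W-w₂)@POINT §1: the block-datum OPERATOR form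
import Summits.HodgeConjecture.HodgeConjecture.Theorems.K2LiuLocalSWTensorMiddleCellTransport   -- ★ (M1) + (Θ-1) `frameConj_blockFlip_eq_tensorEmbLoc_flip`, (Θ-3) `frameConj_nElem`, `tensorEmbLoc_nElem`
import Summits.HodgeConjecture.HodgeConjecture.Theorems.K2LiuBadPlaceWhittakerShells            -- ★ `nElem_conj_eq` (`n(A t D⁻¹) = q n(t) q⁻¹` for `q ∈ P_Δ`)
import Literature.NumberTheory.GelbartRogawski1991.LocalSplittingCMFrameNaturality              -- ★ GR (D) `frameSection_localSplittingDatumCM` (rational-frame naturality of Kudla's CM section)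
import HarnessLib

/-!
# Crux `HLiu418`, #42S block D row D-2, (σ-A) brick (W-w₂)@POINT §3 — THE y-STAGE VECTOR WORD ON THE TENSOR DATUM:
# `op(j̃)(frameOp_{PD}⁻¹(ω(s′((w₁ · m · n(t) · g) ⊗ 1)) Φ)) = γ • ((𝓕 ∘ leviOpPi B₁) ⊠ 1)(unipOpPi c_{t′} (op(j̃)(frameOp_{PD}⁻¹(ω(s′((m · g) ⊗ 1)) Φ))))`, ONE unit `γ`

Cell `hodgecm-mathlib`, crux item hLiu418 = `stmt-HodgeConjecture-24832`; squad K2 ∕ K2Liu; prover F0P2-p07 (g2).  THEOREMS ONLY (no `def`, no instance,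
no notation, no named-fact hypothesis, no `sorry`); lane `--supports stmt-HodgeConjecture-24832 --as helper` (count-neutral helper).

WHY.  ★ [A1] `exists_ne_zero_swSectionTensorLoc_flip_siegel_nElem_mul_eq_integral` (K2Liu-p09) writes the local Siegel–Weil section of the TENSOR datum
`(𝕍 ⊗ V′, T₀ = gramR)` along `w₁ · m · n(t) · g` as `c · ∫_{X₁} (unipOpPi c_{t′} VEC_{m·g})(x₁ ⊔ 0) dx₁`, `VEC_h := op(j̃(p₁,p₂))(frameOp_{PD}⁻¹(ω(s′(h ⊗ 1)) Φ))`.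
The (σ-A) ζ-stage (K2Liu-p08 (g6) (an-3c), pieces (B)(C)) needs the VECTOR `VEC_{w₁·m·n(t)·g}` itself, at a general point — ★ (W-w₂)@POINT
(`K2LiuLocalSWCornerVectorAtPoint` §1–§2) gives it on the BLOCK datum `T₁ ⊕ᶠ T₂`; this file carries it to the tensor datum through the rational frame
`PD = P ⊕ P` (`Pᵀ · gramR · P = T₁ ⊕ᶠ T₂`).  NO new mathematics: (i) on the tensor side `w₁ · m · n(t) · g = w₁ · n(A t D⁻¹) · (m · g)` (★ `nElem_conj_eq`),
`ω ∘ s′ ∘ (· ⊗ 1)` multiplicative; (ii) the VECTOR-LEVEL transport `ω_{T₁⊕ᶠT₂}(s(g′))(frameOp⁻¹ X) = frameOp⁻¹(ω_{T₀}(s′(PD g′ PD⁻¹)) X)` (§1: ★ GR (D)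
`frameSection_localSplittingDatumCM` — Kudla's CM section transported along `PD` IS the CM section of `T₁ ⊕ᶠ T₂` — read through ★ `toRep_frameSection_apply`),
at `g′ = blkLoc(w_Δ^{T₁})` (★ (Θ-1) `frameConj_blockFlip_eq_tensorEmbLoc_flip`: `PD · blkLoc(w_Δ) · PD⁻¹ = w₁ ⊗ 1`) and at `g′ = n(t′)` (★ (Θ-3) `frameConj_nElem` ⊕ ★
`tensorEmbLoc_nElem`: `PD · n(t′) · PD⁻¹ = n(A t D⁻¹) ⊗ 1` when `P t′ P⁻¹ = reindex_ε((A t D⁻¹) ⊗ 1)`); (iii) ★ (W-w₂)@POINT §1's operator form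
`op(j̃) ∘ ω(s(blkLoc w_Δ)) = γ • ((𝓕 ∘ leviOpPi B₁) ⊠ 1) ∘ op(j̃)` and ★ F4a's exact unipotent word `op(j̃)(ω(s n(t′)) Ξ) = unipOpPi c_{t′} (op(j̃) Ξ)`.
* §1 `toRep_localSplitting_frameOp_symm` — the vector-level frame transport (ii) for EVERY `g′`.
* §2 ★ **`exists_toOp_boxLoc_frameOp_symm_localSplitting_tensorEmbLoc_flip_siegel_nElem_mul_eq_smul_boxEquivSB`** — the title identity, ★ [A1]'s letters VERBATIM
  (minus the outer mover `m₀`, which a vector does not carry, and `hT₀'d`, supplied by ★ `isUnit_det_finSum`), ONE unit `γ` uniform in `t, t′, g, Φ`.  Read at `q₁ ⊔ q₂`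
  by ★ `K2LiuLocalSWCornerVectorAtPointSplit` §1 (`coe_smul_boxEquivSB_fourierOpPi_mul_leviOpPi_refl_unipOpPi_apply_glue`, model-free) it is the split form
  `γ · ∫ ψ_v(x₁ ⬝ᵥ q₁) (|det B₁|^{-1/2} ψ_v(qf u′) VEC_{m·g}(u′)) dx₁`, `u′ = B₁⁻¹x₁ ⊔ q₂` — (C) for the consumer is zero lines.
HONEST LABEL.  Count-neutral helper: `HC_CM` is proved only modulo the 7 printed citations (2 remaining named inputs: hLiu418 = `stmt-HodgeConjecture-24832`,
h413 = `stmt-HodgeConjecture-24833`) until rung 0 closes; `hcone`∕`hZ` stay BY VALUE (R2) per M-160f until (an-1)–(an-3) ★.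

## References
* [Kudla1994] S. S. Kudla, Israel J. Math. 87 (1994), §3 Thm. 3.1.   * [GelbartRogawski1991] S. Gelbart, J. Rogawski, §3.1 Remark p. 457.
* [MoeglinVignerasWaldspurger1987] C. Mœglin, M.-F. Vignéras, J.-L. Waldspurger, LNM 1291 (1987), Chap. 2 I.7, II.1 Rem. (3), (6), II.6.
* [HarrisKudlaSweet1996] M. Harris, S. Kudla, W. J. Sweet, J. Amer. Math. Soc. 9 (1996), §1 (1.11)–(1.12), (1.15).
* [Weil1964] A. Weil, Acta Math. 111 (1964), n° 13 (16), p. 160.   * [Rangarao1993] R. Ranga Rao, Pacific J. Math. 157 (1993), Lemma 3.2 (3.8), p. 351.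
-/

set_option autoImplicit false
set_option linter.dupNamespace false -- the mandated namespace repeats `HodgeConjecture.HodgeConjecture`

noncomputable section

open scoped Matrix Kronecker
open NumberField IsDedekindDomain MeasureTheory Matrix
open Literature.RepresentationTheory.HeisenbergGroup Literature.RepresentationTheory.HeisenbergGroup.SymplecticMatrix
open Literature.NumberTheory.Automorphic Literature.NumberTheory.Automorphic.UnitaryGroup Literature.NumberTheory.Weil1964
open Literature.NumberTheory.GaloisRepresentations Literature.NumberTheory.GaloisRepresentations.IsNonarchimedeanLocalField
open Literature.RepresentationTheory.HarrisKudlaSweet1996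
open Literature.NumberTheory.GelbartRogawski1991 Literature.NumberTheory.GelbartRogawski1991.GRConstruction
open Literature.NumberTheory.GelbartRogawski1991.AdaptedBlocks
open Literature.NumberTheory.GelbartRogawski1991.UnitaryDualPair
open Literature.NumberTheory.GelbartRogawski1991.UnitaryDualPair.LocalSplitting
open Literature.NumberTheory.GelbartRogawski1991.UnitaryDualPair.LocalSplitting.FrameTransport
open Literature.NumberTheory.GelbartRogawski1991.UnitaryDualPair.LocalSplitting.DoubledBlock
open Literature.NumberTheory.K2Lit.SiegelDoubled
open Summit.HodgeConjecture.HodgeConjecture.Cruxes.HLiu418.K2LiuLocalSWSectionDefs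
open Summit.HodgeConjecture.HodgeConjecture.Cruxes.HLiu418.K2LiuLocalSWBigCellWords
open Summit.HodgeConjecture.HodgeConjecture.Cruxes.HLiu418.K2LiuLocalSWMiddleCellFunctional
open Summit.HodgeConjecture.HodgeConjecture.Cruxes.HLiu418.K2LiuLocalSWTensorBlockTransport
open Summit.HodgeConjecture.HodgeConjecture.Cruxes.HLiu418.K2LiuLocalSWTensorBlockFrame
open Summit.HodgeConjecture.HodgeConjecture.Cruxes.HLiu418.K2LiuLocalSWTensorBigCellLetters
open Summit.HodgeConjecture.HodgeConjecture.Cruxes.HLiu418.K2LiuLocalSWTensorMiddleCellTransport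
open Summit.HodgeConjecture.HodgeConjecture.Cruxes.HLiu418.K2LiuLocalSWFlipElements (adapt_matA_blkLoc_weylDelta)
open Summit.HodgeConjecture.HodgeConjecture.Cruxes.HLiu418.K2LiuBadPlaceWhittakerShells (nElem_conj_eq)
open Summit.HodgeConjecture.HodgeConjecture.Cruxes.HLiu418.K2LiuLocalSWCornerVectorAtPoint (exists_toOp_boxLoc_localSplitting_blkLoc_weylDelta_eq_smul_boxEquivSB)

namespace Summit.HodgeConjecture.HodgeConjecture.Cruxes.HLiu418.K2LiuLocalSWCornerVectorAtPointTensor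

variable (L : Type) [Field L] [NumberField L] [IsCMField L]
variable {N M : ℕ} (e : Fin N × Fin M ≃ Fin 2)
  (dV : Fin N → L) (hdV : ∀ i, IsCMField.complexConj L (dV i) = dV i)
  (dW : Fin M → L) (hdW : ∀ i, IsCMField.complexConj L (dW i) = dW i)
variable {M₂ M' : ℕ} (eW : Fin M × Fin M₂ ≃ Fin M') (e' : Fin N × Fin M' ≃ Fin (M₂ + M₂))
  (dV' : Fin M₂ → L) (hdV' : ∀ k, IsCMField.complexConj L (dV' k) = dV' k)
  (v : HeightOneSpectrum (𝓞 (Fp L)))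
  [MeasurableSpace (v.adicCompletion (Fp L))] [BorelSpace (v.adicCompletion (Fp L))]
  (μ : Measure (v.adicCompletion (Fp L))) [μ.IsAddHaarMeasure]
  (χ : HeckeCharacter L) (hχ : IsSplittingChar L 1 χ)

/-! ## §1 The vector-level frame transport of Kudla's CM section (every `g′`) -/

set_option maxHeartbeats 4000000 in -- class of ★ GR (D) `frameSection_localSplittingDatumCM` (4M there)
/-- **VECTOR-LEVEL (M1)**: for every `g′ ∈ U((T₁ ⊕ᶠ T₂)^𝔻 ⊗ 1)(L⁺_v)` and every `X ∈ 𝒮`,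
`ω_{T₁⊕ᶠT₂}(s(g′)) (frameOp_{PD}⁻¹ X) = frameOp_{PD}⁻¹ (ω_{T₀}(s′(PD · g′ · PD⁻¹)) X)` — Kudla's CM section of the tensor Gram matrix `T₀ = gramR` transported
along the rational frame `PD` IS the CM section of `T₁ ⊕ᶠ T₂` (★ GR (D) `frameSection_localSplittingDatumCM`), and `frameOp` intertwines (★ `toRep_frameSection_apply`).
[cite: Kudla1994, §3 Thm. 3.1] [cite: GelbartRogawski1991, §3.1 Remark p. 457] [cite: MoeglinVignerasWaldspurger1987, Chap. 2 I.7, II.1 Rem. (3)] -/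
theorem toRep_localSplitting_frameOp_symm (hM₂ : 0 < M₂ + M₂)
    (hT₀d : IsUnit (gramR L e' dV hdV (tensorFrame L dW eW dV') (tensorFrame_real L dW hdW eW dV' hdV')).det)
    {T₁ T₂ : Matrix (Fin M₂) (Fin M₂) (Fp L)}
    (P : GL (Fin (M₂ + M₂)) (Fp L))
    (hP : ((P : Matrix (Fin (M₂ + M₂)) (Fin (M₂ + M₂)) (Fp L)))ᵀ *
        gramR L e' dV hdV (tensorFrame L dW eW dV') (tensorFrame_real L dW hdW eW dV' hdV') * (P : Matrix _ _ (Fp L)) =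
      UnitaryGroup.finSum M₂ M₂ T₁ T₂)
    (t' : Fin (M₂ + M₂) → Fp L) (hT' : UnitaryGroup.finSum M₂ M₂ T₁ T₂ = Matrix.diagonal t')
    {PD : GL (Fin ((M₂ + M₂) + (M₂ + M₂))) (Fp L)} (hPD : PD = UnitaryGroup.reindexGL (e₂ (M₂ + M₂)) (UnitaryGroup.blockDiagGL (P, P)))
    (hT₁ : T₁.IsSymm) (hT₂ : T₂.IsSymm) (hT₁d : IsUnit T₁.det) (hT₂d : IsUnit T₂.det)
    (g' : UnitaryGroup.localPi L (IsCMField.complexConj L) ((M₂ + M₂) + (M₂ + M₂))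
      ((gramD (Fp L) (M₂ + M₂) (UnitaryGroup.finSum M₂ M₂ T₁ T₂)).map (algebraMap (Fp L) L)) v)
    (X : SchwartzBruhat (Fin ((M₂ + M₂) + (M₂ + M₂)) → v.adicCompletion (Fp L))) :
    MpPsi.toRep (localSchrodinger (Fp L) ((M₂ + M₂) + (M₂ + M₂)) (gramD (Fp L) (M₂ + M₂) (UnitaryGroup.finSum M₂ M₂ T₁ T₂)) v)
        ((localSplittingDatumCM L v μ (M₂ + M₂) (UnitaryGroup.isSymm_finSum hT₁ hT₂) (isUnit_det_finSum L M₂ M₂ hT₁d hT₂d) rfl χ hχ).localSplitting g')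
        ((frameOp (Fp L) v ((M₂ + M₂) + (M₂ + M₂)) PD).symm X) =
      (frameOp (Fp L) v ((M₂ + M₂) + (M₂ + M₂)) PD).symm
        (MpPsi.toRep (localSchrodinger (Fp L) ((M₂ + M₂) + (M₂ + M₂))
            (gramD (Fp L) (M₂ + M₂) (gramR L e' dV hdV (tensorFrame L dW eW dV') (tensorFrame_real L dW hdW eW dV' hdV'))) v)
          ((localSplittingDatumCM L v μ (M₂ + M₂)
              (gramR_isSymm L e' dV hdV (tensorFrame L dW eW dV') (tensorFrame_real L dW hdW eW dV' hdV')) hT₀d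
              (hermD_eq_map_gramD L e' dV hdV (tensorFrame L dW eW dV') (tensorFrame_real L dW hdW eW dV' hdV')) χ hχ).localSplitting
            (frameConj (Fp L) L (IsCMField.complexConj L) v ((M₂ + M₂) + (M₂ + M₂))
              (hermD_eq_map_gramD L e' dV hdV (tensorFrame L dW eW dV') (tensorFrame_real L dW hdW eW dV' hdV')) rfl PD
              (transpose_pd_mul_gramD_mul_pd (Fp L) (M₂ + M₂) P hP hPD) g'))
          X) := by
  have h := toRep_frameSection_apply (Fp L) L (IsCMField.complexConj L) v ((M₂ + M₂) + (M₂ + M₂))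
    (hermD_eq_map_gramD L e' dV hdV (tensorFrame L dW eW dV') (tensorFrame_real L dW hdW eW dV' hdV'))
    (rfl : (gramD (Fp L) (M₂ + M₂) (UnitaryGroup.finSum M₂ M₂ T₁ T₂)).map (algebraMap (Fp L) L) =
      (gramD (Fp L) (M₂ + M₂) (UnitaryGroup.finSum M₂ M₂ T₁ T₂)).map (algebraMap (Fp L) L))
    PD (transpose_pd_mul_gramD_mul_pd (Fp L) (M₂ + M₂) P hP hPD)
    (localSplittingDatumCM L v μ (M₂ + M₂) (gramR_isSymm L e' dV hdV (tensorFrame L dW eW dV') (tensorFrame_real L dW hdW eW dV' hdV')) hT₀d (hermD_eq_map_gramD L e' dV hdV (tensorFrame L dW eW dV') (tensorFrame_real L dW hdW eW dV' hdV')) χ hχ).localSplitting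
    g' ((frameOp (Fp L) v ((M₂ + M₂) + (M₂ + M₂)) PD).symm X)
  rw [frameSection_localSplittingDatumCM L v μ (M₂ + M₂) hM₂ t' hT' (gramR_isSymm L e' dV hdV (tensorFrame L dW eW dV') (tensorFrame_real L dW hdW eW dV' hdV')) hT₀d
      (UnitaryGroup.isSymm_finSum hT₁ hT₂) (isUnit_det_finSum L M₂ M₂ hT₁d hT₂d) P hP hPD (hermD_eq_map_gramD L e' dV hdV (tensorFrame L dW eW dV') (tensorFrame_real L dW hdW eW dV' hdV')) rfl χ hχ,
    LinearEquiv.apply_symm_apply] at h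
  simpa only [MonoidHom.comp_apply] using h

/-! ## §2 ★ The y-stage VECTOR word on the tensor datum -/

set_option maxHeartbeats 16000000 in -- MEASURED 2026-09-05: 4 000 000 ∕ 8 000 000 ✗ (`whnf`: ≈ 12 rewrites, each retyping the TWO doubled CM telescopes — tensor and block datum), 16 000 000 ✓ (≈ 150 s)
/-- ★ **(W-w₂)@POINT §3 — THE y-STAGE VECTOR WORD ON THE TENSOR DATUM.**  With ★ [A1] `exists_ne_zero_swSectionTensorLoc_flip_siegel_nElem_mul_eq_integral`'s data
VERBATIM (lines `i₀ ≠ i₁`, block permutation `σ`, `P`, `Pᵀ · gramR · P = T₁ ⊕ᶠ T₂` diagonal, `PD = P ⊕ P`, a flip `w₁` of the line `i₀`, a Siegel element `m`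
of `U(𝕍^𝔻)(L⁺_v)` (`blkC (matA m) = 0`), the block data `p₁ hW₁ B₁ p₂` over movers) — minus the outer mover `m₀` — there is ONE unit `γ` with, for every skew `t`,
every block-side skew `t′` reading `A t D⁻¹` through the frame (`hPX`), every `g` and every `Φ`:
`op(j̃(p₁,p₂)) (frameOp_{PD}⁻¹ (ω(s′((w₁ · m · n(t) · g) ⊗ 1)) Φ)) = γ • ((𝓕 ∘ leviOpPi B₁) ⊠ 1) (unipOpPi c_{t′} (op(j̃(p₁,p₂)) (frameOp_{PD}⁻¹ (ω(s′((m · g) ⊗ 1)) Φ))))`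
— ★ [A1] ∕ ★ (M2a-C2a) BEFORE `∫_{X₁} (·)(x₁ ⊔ 0)`, as a vector.  Read at any `q₁ ⊔ q₂` by ★ `K2LiuLocalSWCornerVectorAtPointSplit` §1 (zero lines).
[cite: Kudla1994, §3 Thm. 3.1] [cite: HarrisKudlaSweet1996, §1 (1.11)–(1.12), (1.15)] [cite: MoeglinVignerasWaldspurger1987, Chap. 2 I.7, II.1 Rem. (3), (6), II.6]
[cite: Weil1964, n° 13 (16), p. 160] [cite: Rangarao1993, Lemma 3.2 (3.8), p. 351] -/
theorem exists_toOp_boxLoc_frameOp_symm_localSplitting_tensorEmbLoc_flip_siegel_nElem_mul_eq_smul_boxEquivSB (hM₂ : 0 < M₂ + M₂)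
    (hT₀d : IsUnit (gramR L e' dV hdV (tensorFrame L dW eW dV') (tensorFrame_real L dW hdW eW dV' hdV')).det)
    {i₀ i₁ : Fin 2} (hi : i₀ ≠ i₁) {σ : Equiv.Perm (Fin (M₂ + M₂))}
    (hσ₀ : ∀ k, σ (epsV e eW e' (i₀, k)) = finSumFinEquiv (Sum.inl k)) (hσ₁ : ∀ k, σ (epsV e eW e' (i₁, k)) = finSumFinEquiv (Sum.inr k))
    {T₁ T₂ : Matrix (Fin M₂) (Fin M₂) (Fp L)}
    (P : GL (Fin (M₂ + M₂)) (Fp L)) (hPσ : (P : Matrix (Fin (M₂ + M₂)) (Fin (M₂ + M₂)) (Fp L)) = σ.toPEquiv.toMatrix)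
    (hP : ((P : Matrix (Fin (M₂ + M₂)) (Fin (M₂ + M₂)) (Fp L)))ᵀ *
        gramR L e' dV hdV (tensorFrame L dW eW dV') (tensorFrame_real L dW hdW eW dV' hdV') * (P : Matrix _ _ (Fp L)) =
      UnitaryGroup.finSum M₂ M₂ T₁ T₂)
    (t' : Fin (M₂ + M₂) → Fp L) (hT' : UnitaryGroup.finSum M₂ M₂ T₁ T₂ = Matrix.diagonal t')
    {PD : GL (Fin ((M₂ + M₂) + (M₂ + M₂))) (Fp L)} (hPD : PD = UnitaryGroup.reindexGL (e₂ (M₂ + M₂)) (UnitaryGroup.blockDiagGL (P, P)))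
    {w₁ : UnitaryGroup.localPi L (IsCMField.complexConj L) (2 + 2) (hermD L e dV hdV dW hdW) v}
    (hw₁ : adapt (matA (Fp L) L (IsCMField.complexConj L) v 2 w₁) =
      Matrix.fromBlocks (1 - Matrix.single i₀ i₀ 1) (Matrix.single i₀ i₀ 1) (Matrix.single i₀ i₀ 1) (1 - Matrix.single i₀ i₀ 1))
    -- the block data of ★ (W-w₂)@POINT §1 (`j̃(p₁,p₂)`, the Cayley-type `p₁` with its Weyl word `hW₁`, movers `hp₁ hp₂`)
    (hM₂' : 0 < M₂) (t₁ : Fin M₂ → Fp L) (hT₁t : T₁ = Matrix.diagonal t₁) (hT₁ : T₁.IsSymm) (hT₂ : T₂.IsSymm)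
    (hT₁d : IsUnit T₁.det) (hT₂d : IsUnit T₂.det)
    (hTv₁ : IsUnit (localGram (Fp L) (M₂ + M₂) (gramD (Fp L) M₂ T₁) v).det)
    (p₁ : LocalMp (Fp L) (M₂ + M₂) (gramD (Fp L) M₂ T₁) v)
    (hp₁ : (deltaLagrangian (Fp L) v M₂).map (toLin (Fp L) v (MpPsi.proj _ p₁)) = lagrangianY (Fp L) (M₂ + M₂) v)
    (B₁ : GL (Fin (M₂ + M₂)) (v.adicCompletion (Fp L)))
    (hW₁ : MpPsi.proj _ p₁ * iotaD (Fp L) L (IsCMField.complexConj L) (complexConj_imagUnit L) (imagUnit_ne_zero L)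
        (imagUnit_mul_self L) v M₂ hT₁ rfl (weylDelta (Fp L) L (IsCMField.complexConj L) v M₂ (T₀ := T₁) rfl) * (MpPsi.proj _ p₁)⁻¹ =
      (transportSp (localGram (Fp L) (M₂ + M₂) (gramD (Fp L) M₂ T₁) v) hTv₁ (SymplecticGroup.symJ _ _))⁻¹ *
        transportSp (localGram (Fp L) (M₂ + M₂) (gramD (Fp L) M₂ T₁) v) hTv₁ (levi B₁))
    {m : ℤ} (hm : (adeleAddCharAt (Fp L) v).HasConductorExp m)
    (p₂ : LocalMp (Fp L) (M₂ + M₂) (gramD (Fp L) M₂ T₂) v)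
    (hp₂ : (deltaLagrangian (Fp L) v M₂).map (toLin (Fp L) v (MpPsi.proj _ p₂)) = lagrangianY (Fp L) (M₂ + M₂) v)
    -- the Siegel element between the flip and the unipotent ([A1-mat] §3: `m := w₁⁻¹ · φ(weylTwo)`)
    {m : UnitaryGroup.localPi L (IsCMField.complexConj L) (2 + 2) (hermD L e dV hdV dW hdW) v}
    (hmC : blkC (matA (Fp L) L (IsCMField.complexConj L) v 2 m) = 0) :
    ∃ γ : ℂˣ, ∀ (t : Matrix (Fin 2) (Fin 2) (LocalRing L v))
      (ht : (t.map (conjLocal L (IsCMField.complexConj L) v))ᵀ * gramS (Fp L) L v 2 (gramR L e dV hdV dW hdW) + gramS (Fp L) L v 2 (gramR L e dV hdV dW hdW) * t = 0)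
      (hAtD : (((blkA (matA (Fp L) L (IsCMField.complexConj L) v 2 m) * t * (blkD (matA (Fp L) L (IsCMField.complexConj L) v 2 m))⁻¹)).map (conjLocal L (IsCMField.complexConj L) v))ᵀ * gramS (Fp L) L v 2 (gramR L e dV hdV dW hdW) +
        gramS (Fp L) L v 2 (gramR L e dV hdV dW hdW) * (blkA (matA (Fp L) L (IsCMField.complexConj L) v 2 m) * t * (blkD (matA (Fp L) L (IsCMField.complexConj L) v 2 m))⁻¹) = 0)
      (tb : Matrix (Fin (M₂ + M₂)) (Fin (M₂ + M₂)) (LocalRing L v))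
      (htb : (tb.map (conjLocal L (IsCMField.complexConj L) v))ᵀ * gramS (Fp L) L v (M₂ + M₂) (UnitaryGroup.finSum M₂ M₂ T₁ T₂) +
        gramS (Fp L) L v (M₂ + M₂) (UnitaryGroup.finSum M₂ M₂ T₁ T₂) * tb = 0)
      (hPX : (P : Matrix (Fin (M₂ + M₂)) (Fin (M₂ + M₂)) (Fp L)).map ((UnitaryGroup.toLocalRing L v).comp (algebraMap (Fp L) (v.adicCompletion (Fp L)))) * tb *
        ((P⁻¹ : GL (Fin (M₂ + M₂)) (Fp L)) : Matrix (Fin (M₂ + M₂)) (Fin (M₂ + M₂)) (Fp L)).map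
          ((UnitaryGroup.toLocalRing L v).comp (algebraMap (Fp L) (v.adicCompletion (Fp L)))) =
        Matrix.reindex (epsV e eW e') (epsV e eW e') ((blkA (matA (Fp L) L (IsCMField.complexConj L) v 2 m) * t * (blkD (matA (Fp L) L (IsCMField.complexConj L) v 2 m))⁻¹) ⊗ₖ (1 : Matrix (Fin M₂) (Fin M₂) (LocalRing L v))))
      (g : UnitaryGroup.localPi L (IsCMField.complexConj L) (2 + 2) (hermD L e dV hdV dW hdW) v)
      (Φ : SchwartzBruhat (Fin ((M₂ + M₂) + (M₂ + M₂)) → v.adicCompletion (Fp L))),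
      MpPsi.toOp _ (boxLoc (Fp L) v M₂ M₂ (T₁ := T₁) (T₂ := T₂) (p₁, p₂))
              ((frameOp (Fp L) v ((M₂ + M₂) + (M₂ + M₂)) PD).symm
                (MpPsi.toRep (localSchrodinger (Fp L) ((M₂ + M₂) + (M₂ + M₂))
                  (gramD (Fp L) (M₂ + M₂) (gramR L e' dV hdV (tensorFrame L dW eW dV') (tensorFrame_real L dW hdW eW dV' hdV'))) v)
                ((localSplittingDatumCM L v μ (M₂ + M₂)
                  (gramR_isSymm L e' dV hdV (tensorFrame L dW eW dV') (tensorFrame_real L dW hdW eW dV' hdV')) hT₀d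
                  (hermD_eq_map_gramD L e' dV hdV (tensorFrame L dW eW dV') (tensorFrame_real L dW hdW eW dV' hdV')) χ hχ).localSplitting
                  (tensorEmbLoc L e dV hdV dW hdW eW e' dV' hdV' v
                    (w₁ * m * nElem (Fp L) L (IsCMField.complexConj L) v 2 (T₀ := gramR L e dV hdV dW hdW) (hermD_eq_map_gramD L e dV hdV dW hdW) t ht * g))) Φ)) =
        (γ : ℂ) • boxEquivSB (v.adicCompletion (Fp L)) (blkIdx M₂ M₂)
          (fourierOpPi μ (isContinuousNontrivial_adeleAddCharAt (Fp L) v) hm * leviOpPi (glEquiv B₁)) (LinearEquiv.refl ℂ _)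
          (unipOpPi (isLocallyConstant_of_isContinuousNontrivial (isContinuousNontrivial_adeleAddCharAt (Fp L) v))
            (Matrix.mulVecLin (cOfFix (localGram (Fp L) ((M₂ + M₂) + (M₂ + M₂)) (gramD (Fp L) (M₂ + M₂) (UnitaryGroup.finSum M₂ M₂ T₁ T₂)) v)
              (MpPsi.proj _ (boxLoc (Fp L) v M₂ M₂ (T₁ := T₁) (T₂ := T₂) (p₁, p₂)) *
                iotaD (Fp L) L (IsCMField.complexConj L) (complexConj_imagUnit L) (imagUnit_ne_zero L) (imagUnit_mul_self L) v
                  (M₂ + M₂) (UnitaryGroup.isSymm_finSum hT₁ hT₂) rfl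
                  (nElem (Fp L) L (IsCMField.complexConj L) v (M₂ + M₂) (T₀ := UnitaryGroup.finSum M₂ M₂ T₁ T₂) rfl tb htb) *
                (MpPsi.proj _ (boxLoc (Fp L) v M₂ M₂ (T₁ := T₁) (T₂ := T₂) (p₁, p₂)))⁻¹)))
            (MpPsi.toOp _ (boxLoc (Fp L) v M₂ M₂ (T₁ := T₁) (T₂ := T₂) (p₁, p₂))
              ((frameOp (Fp L) v ((M₂ + M₂) + (M₂ + M₂)) PD).symm
                (MpPsi.toRep (localSchrodinger (Fp L) ((M₂ + M₂) + (M₂ + M₂))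
                  (gramD (Fp L) (M₂ + M₂) (gramR L e' dV hdV (tensorFrame L dW eW dV') (tensorFrame_real L dW hdW eW dV' hdV'))) v)
                ((localSplittingDatumCM L v μ (M₂ + M₂)
                  (gramR_isSymm L e' dV hdV (tensorFrame L dW eW dV') (tensorFrame_real L dW hdW eW dV' hdV')) hT₀d
                  (hermD_eq_map_gramD L e' dV hdV (tensorFrame L dW eW dV') (tensorFrame_real L dW hdW eW dV' hdV')) χ hχ).localSplitting
                  (tensorEmbLoc L e dV hdV dW hdW eW e' dV' hdV' v (m * g))) Φ))) :
              SchwartzBruhat (Fin ((M₂ + M₂) + (M₂ + M₂)) → v.adicCompletion (Fp L))) := by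
  obtain ⟨γ, hγ⟩ := exists_toOp_boxLoc_localSplitting_blkLoc_weylDelta_eq_smul_boxEquivSB L v μ M₂ M₂ hT₁ hT₂ hT₁d hT₂d χ hχ hM₂' t₁ hT₁t hTv₁
    p₁ B₁ hW₁ hm p₂
  refine ⟨γ, fun t ht hAtD tb htb hPX g Φ => ?_⟩
  have hPj := map_deltaLagrangian_proj_boxLoc L v M₂ M₂ p₁ p₂ hp₁ hp₂
  -- (1) tensor side: the Siegel element moves through the unipotent, `w₁ · m · n(t) · g = w₁ · (n(A t D⁻¹) · (m · g))` (★ `nElem_conj_eq`)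
  have hconj := nElem_conj_eq (Fp L) L (IsCMField.complexConj L) v 2 (hermD_eq_map_gramD L e dV hdV dW hdW) hmC ht hAtD
  have hsplit : w₁ * m * nElem (Fp L) L (IsCMField.complexConj L) v 2 (T₀ := gramR L e dV hdV dW hdW) (hermD_eq_map_gramD L e dV hdV dW hdW) t ht * g =
      w₁ * (nElem (Fp L) L (IsCMField.complexConj L) v 2 (T₀ := gramR L e dV hdV dW hdW) (hermD_eq_map_gramD L e dV hdV dW hdW)
        (blkA (matA (Fp L) L (IsCMField.complexConj L) v 2 m) * t * (blkD (matA (Fp L) L (IsCMField.complexConj L) v 2 m))⁻¹) hAtD * (m * g)) := by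
    rw [hconj]
    simp only [mul_assoc, inv_mul_cancel_left]
  -- (2) the VECTOR-LEVEL frame transport (§1) at the block flip (★ (Θ-1)) and at the Siegel unipotent (★ (Θ-3) ⊕ ★ `tensorEmbLoc_nElem`)
  have hV1 : ∀ X : SchwartzBruhat (Fin ((M₂ + M₂) + (M₂ + M₂)) → v.adicCompletion (Fp L)),
      (frameOp (Fp L) v ((M₂ + M₂) + (M₂ + M₂)) PD).symm
        (MpPsi.toRep (localSchrodinger (Fp L) ((M₂ + M₂) + (M₂ + M₂)) (gramD (Fp L) (M₂ + M₂) (gramR L e' dV hdV (tensorFrame L dW eW dV') (tensorFrame_real L dW hdW eW dV' hdV'))) v)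
          ((localSplittingDatumCM L v μ (M₂ + M₂)
            (gramR_isSymm L e' dV hdV (tensorFrame L dW eW dV') (tensorFrame_real L dW hdW eW dV' hdV')) hT₀d
            (hermD_eq_map_gramD L e' dV hdV (tensorFrame L dW eW dV') (tensorFrame_real L dW hdW eW dV' hdV')) χ hχ).localSplitting
            (tensorEmbLoc L e dV hdV dW hdW eW e' dV' hdV' v w₁)) X) =
      MpPsi.toRep (localSchrodinger (Fp L) ((M₂ + M₂) + (M₂ + M₂)) (gramD (Fp L) (M₂ + M₂) (UnitaryGroup.finSum M₂ M₂ T₁ T₂)) v)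
        ((localSplittingDatumCM L v μ (M₂ + M₂) (UnitaryGroup.isSymm_finSum hT₁ hT₂) (isUnit_det_finSum L M₂ M₂ hT₁d hT₂d) rfl χ hχ).localSplitting
          (blkLoc (Fp L) L (IsCMField.complexConj L) v M₂ M₂ (T₁ := T₁) (T₂ := T₂) rfl rfl
            (weylDelta (Fp L) L (IsCMField.complexConj L) v M₂ (T₀ := T₁) rfl)))
        ((frameOp (Fp L) v ((M₂ + M₂) + (M₂ + M₂)) PD).symm X) := fun X => by
    rw [toRep_localSplitting_frameOp_symm L dV hdV dW hdW eW e' dV' hdV' v μ χ hχ hM₂ hT₀d P hP t' hT' hPD hT₁ hT₂ hT₁d hT₂d,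
      frameConj_blockFlip_eq_tensorEmbLoc_flip L e dV hdV dW hdW eW e' dV' hdV' v hi hσ₀ hσ₁ P hPσ hP hPD rfl hw₁
        (adapt_matA_blkLoc_weylDelta (Fp L) L (IsCMField.complexConj L) v M₂ M₂ rfl rfl)]
  have hV2 : ∀ X : SchwartzBruhat (Fin ((M₂ + M₂) + (M₂ + M₂)) → v.adicCompletion (Fp L)),
      (frameOp (Fp L) v ((M₂ + M₂) + (M₂ + M₂)) PD).symm
        (MpPsi.toRep (localSchrodinger (Fp L) ((M₂ + M₂) + (M₂ + M₂)) (gramD (Fp L) (M₂ + M₂) (gramR L e' dV hdV (tensorFrame L dW eW dV') (tensorFrame_real L dW hdW eW dV' hdV'))) v)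
          ((localSplittingDatumCM L v μ (M₂ + M₂)
            (gramR_isSymm L e' dV hdV (tensorFrame L dW eW dV') (tensorFrame_real L dW hdW eW dV' hdV')) hT₀d
            (hermD_eq_map_gramD L e' dV hdV (tensorFrame L dW eW dV') (tensorFrame_real L dW hdW eW dV' hdV')) χ hχ).localSplitting
            (tensorEmbLoc L e dV hdV dW hdW eW e' dV' hdV' v
              (nElem (Fp L) L (IsCMField.complexConj L) v 2 (T₀ := gramR L e dV hdV dW hdW) (hermD_eq_map_gramD L e dV hdV dW hdW)
                (blkA (matA (Fp L) L (IsCMField.complexConj L) v 2 m) * t * (blkD (matA (Fp L) L (IsCMField.complexConj L) v 2 m))⁻¹) hAtD))) X) =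
      MpPsi.toRep (localSchrodinger (Fp L) ((M₂ + M₂) + (M₂ + M₂)) (gramD (Fp L) (M₂ + M₂) (UnitaryGroup.finSum M₂ M₂ T₁ T₂)) v)
        ((localSplittingDatumCM L v μ (M₂ + M₂) (UnitaryGroup.isSymm_finSum hT₁ hT₂) (isUnit_det_finSum L M₂ M₂ hT₁d hT₂d) rfl χ hχ).localSplitting
          (nElem (Fp L) L (IsCMField.complexConj L) v (M₂ + M₂) (T₀ := UnitaryGroup.finSum M₂ M₂ T₁ T₂) rfl tb htb))
        ((frameOp (Fp L) v ((M₂ + M₂) + (M₂ + M₂)) PD).symm X) := fun X => by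
    rw [toRep_localSplitting_frameOp_symm L dV hdV dW hdW eW e' dV' hdV' v μ χ hχ hM₂ hT₀d P hP t' hT' hPD hT₁ hT₂ hT₁d hT₂d,
      frameConj_nElem (Fp L) L (IsCMField.complexConj L) v (M₂ + M₂)
        (hermD_eq_map_gramD L e' dV hdV (tensorFrame L dW eW dV') (tensorFrame_real L dW hdW eW dV' hdV')) rfl P hP hPD tb htb
        (Matrix.reindex (epsV e eW e') (epsV e eW e')
          ((blkA (matA (Fp L) L (IsCMField.complexConj L) v 2 m) * t * (blkD (matA (Fp L) L (IsCMField.complexConj L) v 2 m))⁻¹) ⊗ₖ (1 : Matrix (Fin M₂) (Fin M₂) (LocalRing L v))))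
        (skew_reindex_kronecker_one L e dV hdV dW hdW eW e' dV' hdV' v
          (blkA (matA (Fp L) L (IsCMField.complexConj L) v 2 m) * t * (blkD (matA (Fp L) L (IsCMField.complexConj L) v 2 m))⁻¹) hAtD) hPX,
      ← tensorEmbLoc_nElem L e dV hdV dW hdW eW e' dV' hdV' v
          (blkA (matA (Fp L) L (IsCMField.complexConj L) v 2 m) * t * (blkD (matA (Fp L) L (IsCMField.complexConj L) v 2 m))⁻¹) hAtD]
  -- (3) ★ F4a's exact unipotent word through `(π(j̃), op(j̃))` at the transported vector
  have hword := implementer_localOmega_nElem_apply L v μ (M₂ + M₂) (UnitaryGroup.isSymm_finSum hT₁ hT₂) (isUnit_det_finSum L M₂ M₂ hT₁d hT₂d) rfl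
    (localSplittingDatumCM L v μ (M₂ + M₂) (UnitaryGroup.isSymm_finSum hT₁ hT₂) (isUnit_det_finSum L M₂ M₂ hT₁d hT₂d) rfl χ hχ)
    (MpPsi.proj _ (boxLoc (Fp L) v M₂ M₂ (T₁ := T₁) (T₂ := T₂) (p₁, p₂))) hPj
    (MpPsi.toOp _ (boxLoc (Fp L) v M₂ M₂ (T₁ := T₁) (T₂ := T₂) (p₁, p₂))) (MpPsi.toRep_implements _ _) _ htb
    (parabolicAtUnipotents_localSplittingDatumCM L v μ (M₂ + M₂) (UnitaryGroup.isSymm_finSum hT₁ hT₂) (isUnit_det_finSum L M₂ M₂ hT₁d hT₂d) rfl χ hχ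
      (MpPsi.proj _ (boxLoc (Fp L) v M₂ M₂ (T₁ := T₁) (T₂ := T₂) (p₁, p₂))) hPj
      (MpPsi.toOp _ (boxLoc (Fp L) v M₂ M₂ (T₁ := T₁) (T₂ := T₂) (p₁, p₂))) (MpPsi.toRep_implements _ _) _ htb)
    ((frameOp (Fp L) v ((M₂ + M₂) + (M₂ + M₂)) PD).symm
                (MpPsi.toRep (localSchrodinger (Fp L) ((M₂ + M₂) + (M₂ + M₂))
                  (gramD (Fp L) (M₂ + M₂) (gramR L e' dV hdV (tensorFrame L dW eW dV') (tensorFrame_real L dW hdW eW dV' hdV'))) v)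
                ((localSplittingDatumCM L v μ (M₂ + M₂)
                  (gramR_isSymm L e' dV hdV (tensorFrame L dW eW dV') (tensorFrame_real L dW hdW eW dV' hdV')) hT₀d
                  (hermD_eq_map_gramD L e' dV hdV (tensorFrame L dW eW dV') (tensorFrame_real L dW hdW eW dV' hdV')) χ hχ).localSplitting
                  (tensorEmbLoc L e dV hdV dW hdW eW e' dV' hdV' v (m * g))) Φ))
  -- (4) `ω ∘ s′ ∘ (· ⊗ 1)` is multiplicative; transport the two outer factors (2); ★ (W-w₂)@POINT §1's operator form; close with (3)
  rw [hsplit, map_mul, map_mul, map_mul, Module.End.mul_apply, map_mul, map_mul, map_mul, Module.End.mul_apply, hV1, hV2, hγ]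
  congr 2

end Summit.HodgeConjecture.HodgeConjecture.Cruxes.HLiu418.K2LiuLocalSWCornerVectorAtPointTensor

end
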